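import Summits.QuantumFields.YangMills.Theorems.HypercubicLimit.Negative.NonTrivialityBridge
import Literature.MathematicalPhysics.QuantumFieldTheory.LatticeGaugeProofs

/-!
# `HypercubicLimit` — negative-side support: non-triviality in lattice terms; non-abelianness is load-bearing

Second support file for crux `stmt-QuantumFields-8646` (`HypercubicLimit`), extracted from the standing
disprover's work file `Cruxes/HypercubicLimit/Disproof.lean` §3; builds on `Negative/NonTrivialityBridge.lean`.
The crux's non-triviality and convergence clauses are written out verbatim in every statement.

* `twoPointNontrivial_iff_lattice`: under the convergence clause, the non-triviality clause for a species `s`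
  ⇔ the truncated LATTICE two-point function of the smeared `s` on one real pair `u` (negative times), `v`
  (positive times) does not tend to `0` along the scheme — the single number a prover must keep away from `0`.
* `latticeSchwinger_eq_prod_of_subsingleton`, `not_converges_and_twoPointNontrivial_of_subsingleton`,
  `hypercubicLimit_false_without_nonabelian`: for the trivial gauge group every lattice `n`-point function is a
  product of one-point functions, so convergence forces factorisation and non-triviality fails — weakening
  `IsCompactSimpleLieGroup` to "compact, connected, linear" makes `HypercubicLimit` false (`G = PUnit`);
  `punit_connected_not_simple` records that `PUnit` misses exactly non-abelianness. [folklore]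
-/

noncomputable section

open scoped SchwartzMap ComplexConjugate
open MeasureTheory Filter Topology Complex
open Literature.MathematicalPhysics.AQFT Literature.MathematicalPhysics.QuantumLattice
open Literature.MathematicalPhysics.QuantumFieldTheory

namespace Summit.QuantumFields.YangMills.Theorems.HypercubicLimit.Negative

/-! ### The trivial gauge group: non-abelianness of `G` is load-bearing -/

section Subsingleton

variable {G : Type} [Group G] [TopologicalSpace G] [IsTopologicalGroup G] [CompactSpace G]
  [MeasurableSpace G] [BorelSpace G]

omit [Group G] [TopologicalSpace G] [IsTopologicalGroup G] [CompactSpace G] [MeasurableSpace G]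
  [BorelSpace G] in
/-- One-point test functions are automatically off-diagonal (no pair of distinct indices). [folklore] -/
theorem isOffDiagonal_fin_one {E : Type*} [NormedAddCommGroup E] [NormedSpace ℝ E]
    (F : 𝓢((Fin 1 → E), ℂ)) : IsOffDiagonal F := by
  rintro x ⟨i, j, hij, -⟩
  exact absurd (Subsingleton.elim i j) hij

/-- **Non-triviality in lattice terms.** Under the convergence clause, the non-triviality clause for `s`
is EXACTLY: for some real `u` (negative times) and `v` (positive times) the truncated lattice
two-point function of the smeared species `s` does NOT tend to zero along the scheme.  With §4
this is the one number a prover has to keep away from `0` (and an adversary would have to force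
to `0`): `lim_k ⟨Φ_k(u) Φ_k(v)⟩ − ⟨Φ_k(u)⟩⟨Φ_k(v)⟩ ≠ 0` for the smeared curvature `Φ_k`. [folklore] -/
theorem twoPointNontrivial_iff_lattice (r : LatticeRep G) (sch : SpeciesScheme (YMSpecies G))
    (S : LabelledSchwingerFamily (YMSpecies G) (EuclideanSpace ℝ (Fin 4)))
    (hconv : (∀ (n : ℕ), n ≠ 0 → ∀ (σ : Fin n → YMSpecies G) (f : Fin n → 𝓢((EuclideanSpace ℝ (Fin 4)), ℝ))
      (F : 𝓢((Fin n → (EuclideanSpace ℝ (Fin 4))), ℂ)), IsTensorOf F (fun i => ofRealTest (f i)) → IsOffDiagonal F →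
        Tendsto (fun k : ℕ => ((latticeSchwinger r.ρ sch (fun s => s.F) k n σ f : ℝ) : ℂ))
          atTop (𝓝 (S n σ F)))) (s : YMSpecies G) :
    (∃ (F₁ G₁ : 𝓢((Fin 1 → (EuclideanSpace ℝ (Fin 4))), ℂ)) (H₁ : 𝓢((Fin (1 + 1) → (EuclideanSpace ℝ (Fin 4))), ℂ)),
      IsTimeOrdered F₁ ∧ IsTimeOrdered G₁ ∧ IsAppendTensorOf H₁ (osAdjoint F₁) G₁ ∧
        S (1 + 1) (fun _ => s) H₁ ≠ S 1 (fun _ => s) (osAdjoint F₁) * S 1 (fun _ => s) G₁) ↔ ∃ u v : 𝓢((EuclideanSpace ℝ (Fin 4)), ℝ), tsupport u ⊆ {y : (EuclideanSpace ℝ (Fin 4)) | y 0 < 0} ∧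
      tsupport v ⊆ {y : (EuclideanSpace ℝ (Fin 4)) | 0 < y 0} ∧
      ¬ Tendsto (fun k : ℕ =>
          latticeSchwinger r.ρ sch (fun s => s.F) k (1 + 1) (fun _ => s) ![u, v] -
            latticeSchwinger r.ρ sch (fun s => s.F) k 1 (fun _ => s) ![u] *
              latticeSchwinger r.ρ sch (fun s => s.F) k 1 (fun _ => s) ![v]) atTop (𝓝 0) := by
  rw [twoPointNontrivial_iff_real]
  refine exists_congr fun u => exists_congr fun v => and_congr_right fun hu =>
    and_congr_right fun hv => ?_
  have h2 := hconv (1 + 1) (by norm_num) (fun _ => s) ![u, v] (tensor₂ u v) (isTensorOf_tensor₂ u v)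
    (isOffDiagonal_of_halfSpaces hu hv (isTensorOf_tensor₂ u v))
  have hu1 := hconv 1 one_ne_zero (fun _ => s) ![u] (tensor₁ u) (isTensorOf_tensor₁ u)
    (isOffDiagonal_fin_one _)
  have hv1 := hconv 1 one_ne_zero (fun _ => s) ![v] (tensor₁ v) (isTensorOf_tensor₁ v)
    (isOffDiagonal_fin_one _)
  set f : ℕ → ℝ := fun k =>
    latticeSchwinger r.ρ sch (fun s => s.F) k (1 + 1) (fun _ => s) ![u, v] -
      latticeSchwinger r.ρ sch (fun s => s.F) k 1 (fun _ => s) ![u] *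
        latticeSchwinger r.ρ sch (fun s => s.F) k 1 (fun _ => s) ![v] with hf
  have hT : Tendsto (fun k : ℕ => (f k : ℂ)) atTop
      (𝓝 (S (1 + 1) (fun _ => s) (tensor₂ u v) -
        S 1 (fun _ => s) (tensor₁ u) * S 1 (fun _ => s) (tensor₁ v))) :=
    (h2.sub (hu1.mul hv1)).congr fun k => by simp only [hf]; push_cast; ring
  change _ ↔ ¬ Tendsto f atTop (𝓝 0)
  constructor
  · intro hne hreal
    apply hne
    have hc : Tendsto (fun k : ℕ => (f k : ℂ)) atTop (𝓝 ((0 : ℝ) : ℂ)) :=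
      (Complex.continuous_ofReal.tendsto 0).comp hreal
    rw [Complex.ofReal_zero] at hc
    exact sub_eq_zero.1 (tendsto_nhds_unique hT hc)
  · intro hreal heq
    apply hreal
    rw [sub_eq_zero.2 heq] at hT
    have := (Complex.continuous_re.tendsto 0).comp hT
    simpa [Function.comp_def] using this

/-- For a gauge group with one element every lattice `n`-point function is the product of the
one-point functions (all observables are deterministic). [folklore] -/
theorem latticeSchwinger_eq_prod_of_subsingleton [Subsingleton G] {N : ℕ} {κ : Type}
    (ρ : G →* Matrix (Fin N) (Fin N) ℂ) (hρ : Continuous ρ) (sch : SpeciesScheme κ)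
    (obs : κ → LGConfig 4 G → ℝ) (k n : ℕ) (σ : Fin n → κ) (f : Fin n → 𝓢((EuclideanSpace ℝ (Fin 4)), ℝ)) :
    latticeSchwinger ρ sch obs k n σ f =
      ∏ i, latticeSchwinger ρ sch obs k 1 (fun _ => σ i) (fun _ => f i) := by
  haveI := isProbabilityMeasure_wilsonMeasure (d := 4) (L := sch.side k) ρ hρ (sch.β k)
  have hconst : ∀ (h : GaugeConfig 4 (sch.side k) G → ℝ) (U₀ : GaugeConfig 4 (sch.side k) G),
      ∫ U, h U ∂(wilsonMeasure (d := 4) (L := sch.side k) ρ (sch.β k)) = h U₀ := by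
    intro h U₀
    have hc : (fun U => h U) = fun _ => h U₀ := funext fun U => congrArg h (Subsingleton.elim U U₀)
    rw [hc, integral_const, smul_eq_mul, probReal_univ, one_mul]
  set U₀ : GaugeConfig 4 (sch.side k) G := fun _ => 1
  unfold latticeSchwinger
  rw [hconst _ U₀]
  refine Finset.prod_congr rfl fun i _ => ?_
  rw [hconst _ U₀, Fin.prod_univ_one]

/-- **Trivial gauge group ⇒ the two-point function factorises on real tensors** (from the
convergence clause alone, by uniqueness of limits). [folklore] -/
theorem factorizes_of_converges_subsingleton [Subsingleton G] (r : LatticeRep G)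
    (sch : SpeciesScheme (YMSpecies G)) (S : LabelledSchwingerFamily (YMSpecies G) (EuclideanSpace ℝ (Fin 4)))
    (hconv : (∀ (n : ℕ), n ≠ 0 → ∀ (σ : Fin n → YMSpecies G) (f : Fin n → 𝓢((EuclideanSpace ℝ (Fin 4)), ℝ))
      (F : 𝓢((Fin n → (EuclideanSpace ℝ (Fin 4))), ℂ)), IsTensorOf F (fun i => ofRealTest (f i)) → IsOffDiagonal F →
        Tendsto (fun k : ℕ => ((latticeSchwinger r.ρ sch (fun s => s.F) k n σ f : ℝ) : ℂ))
          atTop (𝓝 (S n σ F)))) (s : YMSpecies G) (u v : 𝓢((EuclideanSpace ℝ (Fin 4)), ℝ))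
    (hod : IsOffDiagonal (tensor₂ u v)) :
    S (1 + 1) (fun _ => s) (tensor₂ u v) = S 1 (fun _ => s) (tensor₁ u) * S 1 (fun _ => s) (tensor₁ v) := by
  have h2 := hconv (1 + 1) (by norm_num) (fun _ => s) ![u, v] (tensor₂ u v) (isTensorOf_tensor₂ u v) hod
  have hu := hconv 1 one_ne_zero (fun _ => s) ![u] (tensor₁ u) (isTensorOf_tensor₁ u)
    (isOffDiagonal_fin_one _)
  have hv := hconv 1 one_ne_zero (fun _ => s) ![v] (tensor₁ v) (isTensorOf_tensor₁ v)
    (isOffDiagonal_fin_one _)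
  refine tendsto_nhds_unique h2 ?_
  have hprod : ∀ k, ((latticeSchwinger r.ρ sch (fun s => s.F) k (1 + 1) (fun _ => s) ![u, v] : ℝ) : ℂ) =
      ((latticeSchwinger r.ρ sch (fun s => s.F) k 1 (fun _ => s) ![u] : ℝ) : ℂ) *
      ((latticeSchwinger r.ρ sch (fun s => s.F) k 1 (fun _ => s) ![v] : ℝ) : ℂ) := by
    intro k
    rw [latticeSchwinger_eq_prod_of_subsingleton r.ρ r.continuous, Fin.prod_univ_two]
    push_cast
    congr 2
  simp_rw [hprod]
  exact hu.mul hv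

/-- **The crux's conclusion fails for the trivial group** (which is compact, connected and has a
faithful unitary representation — everything in `IsCompactSimpleLieGroup` except non-abelianness):
the convergence clause forces factorisation, the bridge kills `TwoPointNontrivial`.  Hence any
proof must use that `G` is non-abelian. [folklore] -/
theorem not_converges_and_twoPointNontrivial_of_subsingleton [Subsingleton G] (r : LatticeRep G)
    (sch : SpeciesScheme (YMSpecies G)) (S : LabelledSchwingerFamily (YMSpecies G) (EuclideanSpace ℝ (Fin 4)))
    (hconv : (∀ (n : ℕ), n ≠ 0 → ∀ (σ : Fin n → YMSpecies G) (f : Fin n → 𝓢((EuclideanSpace ℝ (Fin 4)), ℝ))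
      (F : 𝓢((Fin n → (EuclideanSpace ℝ (Fin 4))), ℂ)), IsTensorOf F (fun i => ofRealTest (f i)) → IsOffDiagonal F →
        Tendsto (fun k : ℕ => ((latticeSchwinger r.ρ sch (fun s => s.F) k n σ f : ℝ) : ℂ))
          atTop (𝓝 (S n σ F)))) :
    ¬ (∃ (F₁ G₁ : 𝓢((Fin 1 → (EuclideanSpace ℝ (Fin 4))), ℂ)) (H₁ : 𝓢((Fin (1 + 1) → (EuclideanSpace ℝ (Fin 4))), ℂ)),
      IsTimeOrdered F₁ ∧ IsTimeOrdered G₁ ∧ IsAppendTensorOf H₁ (osAdjoint F₁) G₁ ∧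
        S (1 + 1) (fun _ => r.curvature) H₁ ≠ S 1 (fun _ => r.curvature) (osAdjoint F₁) * S 1 (fun _ => r.curvature) G₁) :=
  not_twoPointNontrivial_of_factorizes S r.curvature fun u v hu hv =>
    factorizes_of_converges_subsingleton r sch S hconv _ u v
      (isOffDiagonal_of_halfSpaces hu hv (isTensorOf_tensor₂ u v))

/-- The trivial group has a (faithful, continuous, unitary) lattice representation. [folklore] -/
def punitRep : LatticeRep PUnit :=
  ⟨1, 1, continuous_const, fun a b _ => Subsingleton.elim a b, fun _ => by simp⟩

/-- The trivial group is connected and linear: of `IsCompactSimpleLieGroup` it misses exactly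
non-abelianness (and it is not `IsSimpleCompactGroup`). [folklore] -/
theorem punit_connected_not_simple :
    ConnectedSpace PUnit ∧ Nonempty (LatticeRep PUnit) ∧ ¬ IsSimpleCompactGroup PUnit :=
  ⟨inferInstance, ⟨punitRep⟩, fun h => by obtain ⟨a, b, hab⟩ := h.2.1; exact hab (Subsingleton.elim _ _)⟩

/-- **`HypercubicLimit` is false without "non-abelian"**: weakening the hypothesis
`IsCompactSimpleLieGroup G` to "compact, connected, with a faithful unitary representation" makes
the statement false (witness `G = PUnit`), already at the level of Converges ∧ TwoPointNontrivial. [folklore] -/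
theorem hypercubicLimit_false_without_nonabelian :
    ¬ (∀ (G : Type) [Group G] [TopologicalSpace G] [IsTopologicalGroup G] [CompactSpace G],
        ConnectedSpace G → Nonempty (LatticeRep G) →
          letI : MeasurableSpace G := borel G
          haveI : BorelSpace G := ⟨rfl⟩
          ∃ (r : LatticeRep G) (sch : SpeciesScheme (YMSpecies G))
            (S : LabelledSchwingerFamily (YMSpecies G) (EuclideanSpace ℝ (Fin 4))),
            (∀ (n : ℕ), n ≠ 0 → ∀ (σ : Fin n → YMSpecies G) (f : Fin n → 𝓢((EuclideanSpace ℝ (Fin 4)), ℝ))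
      (F : 𝓢((Fin n → (EuclideanSpace ℝ (Fin 4))), ℂ)), IsTensorOf F (fun i => ofRealTest (f i)) → IsOffDiagonal F →
        Tendsto (fun k : ℕ => ((latticeSchwinger r.ρ sch (fun s => s.F) k n σ f : ℝ) : ℂ))
          atTop (𝓝 (S n σ F))) ∧
            (∃ (F₁ G₁ : 𝓢((Fin 1 → (EuclideanSpace ℝ (Fin 4))), ℂ)) (H₁ : 𝓢((Fin (1 + 1) → (EuclideanSpace ℝ (Fin 4))), ℂ)),
      IsTimeOrdered F₁ ∧ IsTimeOrdered G₁ ∧ IsAppendTensorOf H₁ (osAdjoint F₁) G₁ ∧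
        S (1 + 1) (fun _ => r.curvature) H₁ ≠ S 1 (fun _ => r.curvature) (osAdjoint F₁) * S 1 (fun _ => r.curvature) G₁)) := by
  intro h
  letI : MeasurableSpace PUnit := borel PUnit
  haveI : BorelSpace PUnit := ⟨rfl⟩
  obtain ⟨r, sch, S, hconv, hnt⟩ := h PUnit inferInstance ⟨punitRep⟩
  exact not_converges_and_twoPointNontrivial_of_subsingleton r sch S hconv hnt

end Subsingleton

end Summit.QuantumFields.YangMills.Theorems.HypercubicLimit.Negative
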